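import Mathlib
import Summits.Ventures.HodgeRepro.LitRankRestrict
import Summits.Ventures.HodgeRepro.LitRankYanai1

/-!
# LitRankRibetLog — Ribet's logarithmic lower bound `2 + log₂ d ≤ rank` for simple CM types, proved

Blind cell `pub-hodge-repro`, seat lit-2 (gen 4).  Discharges the printed fact `Ribet_log2_bound` of
`LitRank.lean`:

* Yanai 1985 Prop. A (c) p.170 (store `paper:doi-10-1017-s0027763000021292` p0002:L27–30):
  "max (2 + log₂ d, 2 + log₂ d′) ≤ rank (K, S) ≤ min (d + 1, d′ + 1) … The first inequality in (c)
  is due to Ribet [2]";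
* Dodson 1987 Theorem 1.0 (iii) p.51 (store `paper:doi-10-1016-0021-8693-87-90242-0` p0003:L6):
  "t ∈ S(n) implies log₂(n) + 2 ≤ t";
* Mai 1989 p.193 (store `paper:doi-10-1016-0022-314x-89-90025-5` p0002:L45–46): "By Ribet [6],
  r ≥ 2 + log₂ d";
* the primary, K. A. Ribet, *Division fields of abelian varieties with complex multiplication*,
  Mém. Soc. Math. France (2) 2 (1980), is NOT held; none of the three held sources prints the
  argument.

**The argument formalised (reconstructed; it is the standard character count — say so in the
record).**  Let `W = span_ℚ {𝟙_{S̃ g} : g ∈ G} ⊆ ℚ^G` be the span of the right translates of the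
type, so `rank = dim W` (`rank_eq_finrank_span_rightTranslates`, Kubota's Lemma 1 through right
translates).  (1) The constant function `1 = 𝟙_{S̃} + 𝟙_{S̃ ρ}` lies in `W` (`mem_iff`), so `W` has a
basis `{1} ∪ {𝟙_{S̃ g_2}, …, 𝟙_{S̃ g_r}}` consisting of `1` and `r − 1` translates
(`exists_linearIndepOn_extension`).  (2) Evaluation at `x ∈ G` is a linear functional on `W`,
determined by its values on that basis: `1` on the first vector and a bit `𝟙_{S̃ g_i}(x) ∈ {0, 1}` on
each of the other `r − 1`; so the evaluation functionals take at most `2^{r−1}` values.  (3) Two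
points `x, y` in different right cosets of `H` give DIFFERENT functionals when the type is simple:
if `𝟙_{S̃ g}(x) = 𝟙_{S̃ g}(y)` for every `g`, then `(y x⁻¹) • S̃ = S̃`, hence `y x⁻¹ ∈ H` by
`IsSimple`; conversely the functionals are constant on right cosets (`𝟙_{S̃ g}` is left-`H`-invariant).
Hence the `[G : H] = 2d` right cosets inject into `{0,1}^{r−1}`: `2d ≤ 2^{r−1}`, i.e.
`2 + log₂ d ≤ r`.  (This is exactly the count "the `2d` characters of the Mumford–Tate torus are
pairwise distinct for simple `A` and each is determined by `r − 1` bits" — the shape of Ribet's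
proof as reported in the surveys; with the primary unavailable the argument is recorded here as a
reconstruction, not as a transcription.)

No new named fact (D-0026); everything below is proved.  Imports: `LitRankRestrict` (right translates,
`indFun`, left-`H`-invariance) and `LitRankYanai1` (`index_eq_two_mul_dim`).
-/

open Finset
open scoped Pointwise

namespace HodgeRepro.Lit2

namespace CMTriple

variable {G : Type*} [Group G] [Fintype G] [DecidableEq G] (T : CMTriple G)

/-- The right translate `𝟙_{S̃ g}` as a function `G → ℚ` (the `g`-th column of `rightMat`). -/
noncomputable abbrev rtFun (g : G) : G → ℚ := indFun (T.S.image (· * g))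

omit [Fintype G] in
/-- `rtFun g x ∈ {0, 1}`. -/
theorem rtFun_eq_zero_or_one (g x : G) : T.rtFun g x = 0 ∨ T.rtFun g x = 1 := by
  unfold rtFun indFun
  split_ifs <;> simp

omit [Fintype G] in
/-- `𝟙_{S̃ g}(x) = 1 ↔ x g⁻¹ ∈ S̃`. -/
theorem rtFun_eq_one_iff (g x : G) : T.rtFun g x = 1 ↔ x * g⁻¹ ∈ T.S := by
  unfold rtFun indFun
  by_cases h : x * g⁻¹ ∈ T.S
  · simp [h]
  · simp [h]

omit [Fintype G] in
/-- The complementary translate: `𝟙_{S̃ g} + 𝟙_{S̃ g ρ} = 1` (from `mem_iff`, `ρ` central). -/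
theorem rtFun_add_rtFun_mul_ρ (g : G) : T.rtFun g + T.rtFun (g * T.ρ) = 1 := by
  funext x
  have hρ : T.ρ⁻¹ = T.ρ := inv_eq_of_mul_eq_one_right T.ρ_mul_self
  have key : x * (g * T.ρ)⁻¹ ∈ T.S ↔ x * g⁻¹ ∉ T.S := by
    rw [mul_inv_rev, hρ, T.ρ_comm g⁻¹, ← mul_assoc, T.mul_ρ_mem_iff]
  simp only [Pi.add_apply, Pi.one_apply, rtFun, indFun, T.mem_image_mul_right_iff]
  by_cases h : x * g⁻¹ ∈ T.S
  · rw [if_pos h, if_neg (key.not.2 (not_not.2 h))]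
    norm_num
  · rw [if_neg h, if_pos (key.2 h)]
    norm_num

omit [Fintype G] in
/-- No translate is the constant function `1` (it would contain both `1` and `ρ`). -/
theorem rtFun_ne_one (g : G) : T.rtFun g ≠ 1 := by
  intro h1
  have ha := congrFun h1 g
  have hb := congrFun h1 (g * T.ρ)
  rw [Pi.one_apply, T.rtFun_eq_one_iff, mul_inv_cancel] at ha
  rw [Pi.one_apply, T.rtFun_eq_one_iff, mul_assoc, T.ρ_comm g⁻¹, mul_inv_cancel_left] at hb
  exact (T.mul_ρ_mem_iff 1).1 (by rwa [one_mul]) ha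

/-- The span `W` of the right translates. -/
noncomputable abbrev rtSpan : Submodule ℚ (G → ℚ) :=
  Submodule.span ℚ (Set.range fun g : G => T.rtFun g)

/-- `rank = dim W`. -/
theorem rank_eq_finrank_rtSpan : T.rank = Module.finrank ℚ T.rtSpan :=
  T.rank_eq_finrank_span_rightTranslates

omit [Fintype G] in
/-- The constant function `1` lies in `W`. -/
theorem one_mem_rtSpan : (1 : G → ℚ) ∈ T.rtSpan := by
  have h := T.rtFun_add_rtFun_mul_ρ 1
  rw [← h]
  exact Submodule.add_mem _ (Submodule.subset_span ⟨1, rfl⟩) (Submodule.subset_span ⟨1 * T.ρ, rfl⟩)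

omit [Fintype G] in
/-- The translates are constant on right cosets: `𝟙_{S̃ g}(h x) = 𝟙_{S̃ g}(x)` for `h ∈ H`. -/
theorem rtFun_mul_of_mem (g : G) {h : G} (hh : h ∈ T.H) (x : G) :
    T.rtFun g (h * x) = T.rtFun g x :=
  T.indFun_image_mem_leftInvariant g h hh x

omit [Fintype G] in
/-- Simplicity separates right cosets: if every translate takes the same value at `x` and at `y`,
then `y x⁻¹ ∈ H`. -/
theorem mul_inv_mem_of_forall_rtFun_eq (hT : T.IsSimple) {x y : G}
    (h : ∀ g : G, T.rtFun g x = T.rtFun g y) : y * x⁻¹ ∈ T.H := by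
  apply hT
  ext u
  rw [Finset.mem_smul_finset]
  constructor
  · rintro ⟨s, hs, rfl⟩
    have h1 := h (s⁻¹ * x)
    have hx1 : T.rtFun (s⁻¹ * x) x = 1 := by
      rw [T.rtFun_eq_one_iff, mul_inv_rev, inv_inv, ← mul_assoc, mul_inv_cancel, one_mul]
      exact hs
    rw [hx1] at h1
    have := (T.rtFun_eq_one_iff _ _).1 h1.symm
    rw [mul_inv_rev, inv_inv, ← mul_assoc] at this
    rw [smul_eq_mul]
    exact this
  · intro hu
    refine ⟨x * y⁻¹ * u, ?_, ?_⟩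
    · have h1 := h (u⁻¹ * y)
      have hy1 : T.rtFun (u⁻¹ * y) y = 1 := by
        rw [T.rtFun_eq_one_iff, mul_inv_rev, inv_inv, ← mul_assoc, mul_inv_cancel, one_mul]
        exact hu
      rw [hy1] at h1
      have := (T.rtFun_eq_one_iff _ _).1 h1
      rwa [mul_inv_rev, inv_inv, ← mul_assoc] at this
    · simp [smul_eq_mul, mul_assoc]

end CMTriple

open CMTriple in
/-- **Ribet's bound** (Yanai 1985 Prop. A (c) first inequality / Dodson 1987 Thm 1.0 (iii) /
Mai 1989 p.193): every simple CM type of dimension `d` has rank `≥ 2 + log₂ d`.  Proof = the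
character count described in the module docstring. -/
theorem Ribet_log2_bound_holds : Ribet_log2_bound := by
  intro G _ _ _ T hT
  classical
  -- the span `W`, its dimension `r = rank`
  set W := T.rtSpan with hW
  have hrank : T.rank = Module.finrank ℚ W := T.rank_eq_finrank_rtSpan
  -- a basis of `W` containing `1` and otherwise made of translates
  have h1W : (1 : G → ℚ) ∈ W := T.one_mem_rtSpan
  have h1ne : (1 : G → ℚ) ≠ 0 := by
    intro h
    have := congrFun h 1
    simp at this
  obtain ⟨b, hbt, h1b, htb, hbli⟩ := exists_linearIndepOn_extension (K := ℚ) (v := id)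
    (LinearIndepOn.singleton (i := (1 : G → ℚ)) h1ne)
    (Set.singleton_subset_iff.2 (Set.mem_insert (1 : G → ℚ) (Set.range fun g : G => T.rtFun g)))
  simp only [Set.image_id] at htb
  have h1b' : (1 : G → ℚ) ∈ b := Set.singleton_subset_iff.1 h1b
  have hbfin : b.Finite := ((Set.finite_range fun g : G => T.rtFun g).insert 1).subset hbt
  -- `span b = W`
  have hspan : Submodule.span ℚ b = W := by
    apply le_antisymm
    · refine (Submodule.span_mono hbt).trans ?_
      rw [Submodule.span_insert_eq_span h1W, hW]
    · rw [hW]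
      exact Submodule.span_le.2 ((Set.subset_insert _ _).trans htb)
  -- `r = |b|`
  set B := hbfin.toFinset with hB
  have hBcoe : (B : Set (G → ℚ)) = b := hbfin.coe_toFinset
  have hr : Module.finrank ℚ W = B.card := by
    rw [← hspan, ← hBcoe]
    exact finrank_span_finset_eq_card (by rw [hBcoe]; exact hbli)
  have h1B : (1 : G → ℚ) ∈ B := by rw [← Finset.mem_coe, hBcoe]; exact h1b'
  -- every element of `b` other than `1` is a translate
  have hmem : ∀ v ∈ b, v = 1 ∨ ∃ g : G, v = T.rtFun g := by
    intro v hv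
    rcases hbt hv with h | ⟨g, rfl⟩
    · exact Or.inl h
    · exact Or.inr ⟨g, rfl⟩
  -- the bit vector of a point
  let B' := B.erase (1 : G → ℚ)
  let Φ : G → (↥B' → Bool) := fun x v => decide (v.1 x = 1)
  -- the bit vector is constant on right cosets
  have hΦcoset : ∀ x y : G, y * x⁻¹ ∈ T.H → Φ x = Φ y := by
    intro x y hxy
    funext v
    have hv : v.1 ∈ b := by
      have := Finset.mem_of_mem_erase v.2
      rwa [← Finset.mem_coe, hBcoe] at this
    rcases hmem v.1 hv with h | ⟨g, hg⟩
    · exact absurd h (Finset.ne_of_mem_erase v.2)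
    · show decide (v.1 x = 1) = decide (v.1 y = 1)
      rw [hg]
      have : T.rtFun g y = T.rtFun g x := by
        have := T.rtFun_mul_of_mem g hxy x
        rwa [inv_mul_cancel_right] at this
      rw [this]
  -- equal bit vectors ⇒ equal evaluations on `W` ⇒ same right coset
  have hΦinj : ∀ x y : G, Φ x = Φ y → y * x⁻¹ ∈ T.H := by
    intro x y hxy
    apply T.mul_inv_mem_of_forall_rtFun_eq hT
    intro g
    -- the functional `v ↦ v x - v y` vanishes on `b`, hence on `W ∋ rtFun g`
    let L : (G → ℚ) →ₗ[ℚ] ℚ :=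
      LinearMap.proj (R := ℚ) (φ := fun _ : G => ℚ) x - LinearMap.proj (R := ℚ) (φ := fun _ : G => ℚ) y
    have hLb : b ⊆ (LinearMap.ker L : Set (G → ℚ)) := by
      intro v hv
      rw [SetLike.mem_coe, LinearMap.mem_ker]
      show v x - v y = 0
      rcases hmem v hv with rfl | ⟨g', rfl⟩
      · simp
      · have hvB' : T.rtFun g' ∈ B' := by
          rw [Finset.mem_erase]
          exact ⟨T.rtFun_ne_one g', by rw [← Finset.mem_coe, hBcoe]; exact hv⟩
        have hx := congrFun hxy ⟨T.rtFun g', hvB'⟩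
        have hx' : (T.rtFun g' x = 1) ↔ (T.rtFun g' y = 1) := by
          have := hx
          simpa [Φ] using this
        rcases T.rtFun_eq_zero_or_one g' x with h0 | h1 <;>
          rcases T.rtFun_eq_zero_or_one g' y with h0' | h1' <;>
          simp_all
    have hLW : W ≤ LinearMap.ker L := by
      rw [← hspan]
      exact Submodule.span_le.2 hLb
    have hg : T.rtFun g ∈ W := Submodule.subset_span ⟨g, rfl⟩
    have := hLW hg
    rw [LinearMap.mem_ker] at this
    change T.rtFun g x - T.rtFun g y = 0 at this
    linarith
  -- descend to right cosets and count
  let Φ' : Quotient (QuotientGroup.rightRel T.H) → (↥B' → Bool) :=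
    Quotient.lift Φ (fun x y hxy => hΦcoset x y ((QuotientGroup.rightRel_apply).1 hxy))
  have hΦ'inj : Function.Injective Φ' := by
    intro q₁ q₂ hq
    induction q₁ using Quotient.inductionOn with
    | h x =>
      induction q₂ using Quotient.inductionOn with
      | h y =>
        apply Quotient.sound
        exact (QuotientGroup.rightRel_apply).2 (hΦinj x y hq)
  have hcard : T.H.index ≤ 2 ^ (B.card - 1) := by
    have h1 : Nat.card (Quotient (QuotientGroup.rightRel T.H)) ≤ Nat.card (↥B' → Bool) :=
      Nat.card_le_card_of_injective Φ' hΦ'inj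
    have h2 : Nat.card (Quotient (QuotientGroup.rightRel T.H)) = T.H.index := by
      show _ = Nat.card (G ⧸ T.H)
      exact Nat.card_congr (QuotientGroup.quotientRightRelEquivQuotientLeftRel T.H)
    have h3 : Nat.card (↥B' → Bool) = 2 ^ (B.card - 1) := by
      rw [Nat.card_fun, Nat.card_eq_fintype_card, Fintype.card_bool, Nat.card_eq_fintype_card,
        Fintype.card_coe, Finset.card_erase_of_mem h1B]
    rw [h2, h3] at h1
    exact h1
  -- arithmetic: `2 d = [G : H] ≤ 2^{r-1}`, `d ≥ 1`, hence `d ≤ 2^{r-2}` and `r ≥ 2`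
  have hindex : T.H.index = 2 * T.dim := T.index_eq_two_mul_dim
  have hdim : 1 ≤ T.dim := by
    by_contra h0
    have hd0 : T.dim = 0 := by omega
    have hidx : T.H.index = 0 := by rw [hindex, hd0]
    exact Subgroup.index_ne_zero_of_finite hidx
  have hB1 : 1 ≤ B.card := Finset.card_pos.2 ⟨1, h1B⟩
  have hr2 : 2 ≤ B.card := by
    by_contra hlt
    have hB1' : B.card = 1 := by omega
    rw [hB1', Nat.sub_self, pow_zero, hindex] at hcard
    omega
  have hdle : T.dim ≤ 2 ^ (B.card - 2) := by
    have h22 : 2 ^ (B.card - 1) = 2 * 2 ^ (B.card - 2) := by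
      rw [← pow_succ']
      congr 1
      omega
    rw [hindex, h22] at hcard
    omega
  -- pass to `ℝ`
  rw [hrank, hr]
  have hdpos : (0 : ℝ) < T.dim := by exact_mod_cast hdim
  have key : Real.logb 2 (T.dim : ℝ) ≤ (B.card : ℝ) - 2 := by
    rw [Real.logb_le_iff_le_rpow (by norm_num) hdpos]
    have hc : ((B.card : ℝ) - 2) = ((B.card - 2 : ℕ) : ℝ) := by
      rw [Nat.cast_sub hr2]; norm_num
    rw [hc, Real.rpow_natCast]
    exact_mod_cast hdle
  linarith

end HodgeRepro.Lit2
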